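import Summits.KontsevichZagierPeriods.KontsevichZagierPeriods.Theorems.HermiteRigidityReductionRigidityDupTowerNormalForm

/-!
# `ReductionRigidity` (stmt-KontsevichZagierPeriods-3407), line `Sketch`: the NORMAL FORM of the box sector at
# finitely many rational levels (`stub_multiLevelNormalForm`)

Route `KontsevichZagierPeriods/HermiteRigidity`, crux `ReductionRigidity` (stmt-3407, summit-equivalent; skeleton
`Cruxes/ReductionRigidity/Lines/Sketch.lean`). Lead seat c7, growth item G16 (the box sector at the `K` rational levels
`L 0, …, L (K−1)`, each `> 1` or `< 0`). The sector is the subgroup of the Kontsevich–Zagier formal period group generated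
by all rescaled box generators `[□ʲ, q x^a/(L k − ∏x)^m]` (`j ≤ w`, `q ∈ ℚ`, `k < K`). This file proves its NORMAL FORM:
every element of the sector is congruent modulo `KZ.relations` to `∑_{k<K} ∑_{i≤w} [□ⁱ, α_{k,i}/(L k − ∏x)]` with rational
`α`. No cross-level move is involved: it is the single-level normal form `levelNormalFormQ` (c4's closure induction over
`genReduction`, with rational coefficients) applied level by level, by induction on `K` — the generator set at `K + 1`
levels is contained in the union of the generator set at `K` levels and the level-`L K` generator set, and the closure
of a union is the join of the closures. The kernel form of Conjecture 1 on this sector is drawn in the sibling file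
`HermiteRigidityReductionRigidityMultiLevelKernelGen.lean`.

References: M. Kontsevich, D. Zagier, *Periods* (2001), §1.2 [cite: KontsevichZagier2001, §1.2]. No definitions are
introduced (normal forms are written out as existentials).
-/

noncomputable section

open MeasureTheory Set MvPolynomial

namespace Summit.KontsevichZagierPeriods.HermiteRigidity.ReductionRigidity

open Literature.NumberTheory.Transcendental
open Literature.NumberTheory.Transcendental.KZ

/-! ## The normal form of the multi-level box sector -/

/-- **Stub `stub_multiLevelNormalForm`** (sub-goal of crux `ReductionRigidity`, stmt-3407, line `Sketch`, lead c7,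
growth G16): **the normal form of the box sector at finitely many rational levels.** For `w K : ℕ` and rational levels
`L k` (each `> 1` or `< 0`), every element of the subgroup generated by the rescaled box generators
`[□ʲ, q x^a/(L k − ∏x)^m]` (`j ≤ w`, `q ∈ ℚ`, `k < K`) is congruent modulo `KZ.relations` to
`∑_{k<K} ∑_{i≤w} [□ⁱ, α_{k,i}/(L k − ∏x)]` with rational `α`. Induction on `K`: at `K = 0` the generator set is empty and
the element is `0`; at `K + 1` the element splits as a sum of an element of the sector at `K` levels (induction
hypothesis) and an element of the level-`L K` sector (`levelNormalFormQ`). [cite: KontsevichZagier2001, §1.2] -/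
theorem stub_multiLevelNormalForm : ∀ (w K : ℕ) (L : ℕ → ℚ), (∀ k, 1 < L k ∨ L k < 0) → ∀ c ∈ AddSubgroup.closure
      {c | ∃ (k j : ℕ) (r : IntegralRep j) (q : ℚ) (a : Fin j → ℕ) (m : ℕ), k < K ∧ j ≤ w ∧ r.domain = cube j ∧
          EqOn r.integrand (fun p => (q : ℝ) * (∏ l, p l ^ a l) / ((L k : ℝ) - ∏ l, p l) ^ m) (cube j) ∧ c = KZ.of r},
    ∃ (α : ℕ → ℕ → ℚ) (s : ℕ → (i : ℕ) → IntegralRep i),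
      (∀ k i, (s k i).domain = cube i ∧ EqOn (s k i).integrand (fun p => (α k i : ℝ) / ((L k : ℝ) - ∏ l, p l)) (cube i)) ∧
      c - ∑ k ∈ Finset.range K, ∑ i ∈ Finset.range (w + 1), KZ.of (s k i) ∈ KZ.relations := by
  intro w K L hL
  induction K with
  | zero =>
    intro c hc
    -- no level: the generator set is empty, `c = 0`
    have hc0 : c = 0 := by
      rw [← AddSubgroup.mem_bot]
      refine (AddSubgroup.closure_le ⊥).2 (fun x hx => ?_) hc
      obtain ⟨k, j, r, q, a, m, hk, -⟩ := hx
      exact absurd hk (Nat.not_lt_zero k)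
    subst hc0
    choose s hs hsi using fun (k i : ℕ) => exists_nfRep (i := i) (hL k) 0
    refine ⟨fun _ _ => 0, s, fun k i => ⟨hs k i, hsi k i⟩, ?_⟩
    rw [Finset.sum_range_zero, sub_zero]
    exact KZ.relations.zero_mem
  | succ K ih =>
    intro c hc
    -- split `c` along: the sector at the `K` levels `L 0, …, L (K-1)`, and the level `L K`
    have hsub :
        ({c | ∃ (k j : ℕ) (r : IntegralRep j) (q : ℚ) (a : Fin j → ℕ) (m : ℕ), k < K + 1 ∧ j ≤ w ∧ r.domain = cube j ∧
            EqOn r.integrand (fun p => (q : ℝ) * (∏ l, p l ^ a l) / ((L k : ℝ) - ∏ l, p l) ^ m) (cube j) ∧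
              c = KZ.of r} : Set FormalRep) ⊆
        {c | ∃ (k j : ℕ) (r : IntegralRep j) (q : ℚ) (a : Fin j → ℕ) (m : ℕ), k < K ∧ j ≤ w ∧ r.domain = cube j ∧
            EqOn r.integrand (fun p => (q : ℝ) * (∏ l, p l ^ a l) / ((L k : ℝ) - ∏ l, p l) ^ m) (cube j) ∧
              c = KZ.of r} ∪
        {c | ∃ (j : ℕ) (r : IntegralRep j) (q : ℚ) (a : Fin j → ℕ) (m : ℕ), j ≤ w ∧ r.domain = cube j ∧
            EqOn r.integrand (fun p => (q : ℝ) * (∏ l, p l ^ a l) / ((L K : ℝ) - ∏ l, p l) ^ m) (cube j) ∧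
              c = KZ.of r} := by
      rintro c ⟨k, j, r, q, a, m, hk, hj, hr, hri, rfl⟩
      rcases Nat.lt_or_ge k K with hk' | hk'
      · exact Or.inl ⟨k, j, r, q, a, m, hk', hj, hr, hri, rfl⟩
      · have hkK : k = K := by omega
        subst hkK
        exact Or.inr ⟨j, r, q, a, m, hj, hr, hri, rfl⟩
    have hc' := AddSubgroup.closure_mono hsub hc
    rw [AddSubgroup.closure_union] at hc'
    obtain ⟨x, hx, y, hy, rfl⟩ := AddSubgroup.mem_sup.1 hc'
    -- normal forms: the `K` lower levels by induction, the level `L K` by `levelNormalFormQ`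
    obtain ⟨α, s, hs, hrelx⟩ := ih x hx
    obtain ⟨δ, v, hv, hyv⟩ := levelNormalFormQ (hL K) w y hy
    refine ⟨fun k i => if k = K then δ i else α k i, fun k i => if k = K then v i else s k i, fun k i => ?_, ?_⟩
    · by_cases hk : k = K
      · simp only [hk, if_true]
        exact hv i
      · simp only [hk, if_false]
        exact hs k i
    · have hsum : ∑ k ∈ Finset.range (K + 1), ∑ i ∈ Finset.range (w + 1), KZ.of (if k = K then v i else s k i) =
          ∑ k ∈ Finset.range K, ∑ i ∈ Finset.range (w + 1), KZ.of (s k i) +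
            ∑ i ∈ Finset.range (w + 1), KZ.of (v i) := by
        rw [Finset.sum_range_succ]
        congr 1
        · refine Finset.sum_congr rfl fun k hk => Finset.sum_congr rfl fun i _ => ?_
          rw [if_neg (Nat.ne_of_lt (Finset.mem_range.1 hk))]
        · refine Finset.sum_congr rfl fun i _ => ?_
          rw [if_pos rfl]
      rw [hsum]
      have key : x + y - (∑ k ∈ Finset.range K, ∑ i ∈ Finset.range (w + 1), KZ.of (s k i) +
          ∑ i ∈ Finset.range (w + 1), KZ.of (v i)) =
          (x - ∑ k ∈ Finset.range K, ∑ i ∈ Finset.range (w + 1), KZ.of (s k i)) +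
            (y - ∑ i ∈ Finset.range (w + 1), KZ.of (v i)) := by
        abel
      rw [key]
      exact KZ.relations.add_mem hrelx hyv

end Summit.KontsevichZagierPeriods.HermiteRigidity.ReductionRigidity

end
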